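import Mathlib
import Summits.AtomisticToContinuum.BoseEinsteinCondensation.Theorems.SoloInformedGaussianDomination

/-!
# The exchange sign for two bodies — Birman–Schwinger in weak form (rung X₀ of the impurity split)

Solo seat `solo-AtomisticToContinuum-informed`, session s13 (report `paper/sharpest.md` §4.10(x),
claims C58–C62).  Companion of `SoloInformedImpuritySplit`.

## What is proved (abstract inner-product form, sorry-free)

Let `h = h₀ + W` with `h₀`, `W` symmetric, `W ≥ 0`, `h ≥ 0` (as real parts of the quadratic forms),
and let `S`, `A` be eigenvectors of `h₀` with the SAME eigenvalue `λ > 0`.  For weak inverses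
`h u_S = S`, `h u_A = A`:

* `bs_identity` : `λ⟨S, u_S⟩ + ⟨W S, u_S⟩ = ⟨S, S⟩` (the first Birman–Schwinger step: the resolvent
  expectation of an `h₀`-eigenvector is the free value minus a correction `Q(S)/λ`,
  `Q(S) := λ·re⟨W S, u_S⟩`);
* `bs_correction_le` : `λ·re⟨W A, u_A⟩ ≤ re⟨A, W A⟩` (`Q(A) ≤ ⟨A, W A⟩`, from `h ≥ 0`);
* `bs_fixedPoint` : with `R₀` a left inverse of `h₀` and `M := W + W R₀ W`, the vector `b := λ u_S`
  solves `M b = W S` (the Birman–Schwinger equation `(1 + W^{1/2} R₀ W^{1/2}) z = W^{1/2} S` without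
  square roots);
* `bs_M_symm`, `bs_M_psd` : `M` is symmetric and positive when `W`, `R₀` are;
* `bs_correction_jensen` : `(re⟨S, W S⟩)² ≤ re⟨S, M S⟩ · re⟨S, W b⟩` (Jensen: `Q(S) ≥ ⟨S,WS⟩²/⟨S,MS⟩`);
* `exchange_identity` : `‖S‖ = ‖A‖ ⇒ λ (re⟨S,u_S⟩ − re⟨A,u_A⟩) = −(re⟨WS,u_S⟩ − re⟨WA,u_A⟩)`;
* `exchange_sign_of_criterion` : if moreover `re⟨A, W A⟩ · re⟨S, M S⟩ ≤ (re⟨S, W S⟩)²` and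
  `re⟨S, M S⟩ > 0` then `re⟨S, u_S⟩ ≤ re⟨A, u_A⟩`;
* `exchange_sign_of_contact` : if `W A = 0` then `re⟨S, u_S⟩ ≤ re⟨A, u_A⟩`.

## Physical reading (paper-only instantiation; report §4.10(x)(d))

Two bosons (`N = 1` in the notation of the split `χ₊ = D + X`), torus `Λ`, total-momentum-`k`
sector with basis `e_p = φ_p ⊗ φ_{k−p}`; `F₁ = e_k`, `F₂ = e_0`, `S = F₁ + F₂` (exchange-even),
`A = F₁ − F₂` (exchange-odd), `‖S‖ = ‖A‖` for `k ≠ 0`; `h₀ = T − E₀(2)` (positive on the sector as soon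
as `E₀(2) < min_p ε(p) + ε(k−p)`, e.g. `L ≥ L₀(v)`), `W = v(x₁ − x₂) ≥ 0`, `R₀ = h₀⁻¹`,
`λ = ε(k) − E₀(2)`, and `X = re⟨F₁, h⁻¹F₂⟩ = (⟨S,h⁻¹S⟩ − ⟨A,h⁻¹A⟩)/4`.  Then `exchange_identity` reads
`4Xλ² = −(Q(S) − Q(A))`; the odd vector vanishes on the diagonal `x₁ = x₂`, so
`⟨A, W A⟩ = (2/|Λ|)∫v(r)(1 − cos k·r) dr ≤ k² M₂(v)/|Λ|` (`M₂ = ∫ v r²`), while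
`⟨S, W S⟩ = 2(v̂(0) + v̂(k))/|Λ|` and `⟨W S, R₀ W S⟩ ≤ C₀(v)/|Λ|` uniformly in `L` (and in small `k`,
`d = 3`).  Consequences: (i) CONTACT interaction (`W A = 0`): `X(k) < 0` for every `k ≠ 0`, every
coupling, every volume satisfying the sector condition (`exchange_sign_of_contact`); (ii) finite range:
`X(k) < 0` for `0 < |k| ≤ k₀(v)`, `L ≥ L₀(v)`, at every coupling (`exchange_sign_of_criterion`).
So for `N = 1` the exchange part of the particle-addition susceptibility has the Fock sign
NON-PERTURBATIVELY: the exchange-odd channel does not see the pair interaction (p-wave suppression)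
and Birman–Schwinger turns the comparison of two resolvent expectations into a sign.  Numerical check
(`work/s14/n1_exchange_bs.py`, 7 two-dimensional tori, 49 momenta): the identity to `10⁻¹⁵`, both
bounds at 49/49, the criterion alone certifies `X < 0` at 39 of the 42 interacting momenta (all those
with `v̂(k) > 0`).  What does NOT lift to `N ≥ 2`: `F₁ + F₂` is an eigenvector of a reference operator
`h₀` with `h − h₀ ≥ 0` only for `N = 1` (for `N ≥ 2` the bath interacts with both labelled particles),
and the zeroth Birman–Schwinger term acquires `+n_k/λ > 0`; statement (X) of the report in the window
remains open.
-/

noncomputable section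

open Complex
open scoped InnerProductSpace ComplexConjugate

namespace Summit.AtomisticToContinuum.BoseEinsteinCondensation.Theorems

universe v

variable {E : Type v} [NormedAddCommGroup E] [InnerProductSpace ℂ E]

/-- **First Birman–Schwinger step (weak form).** If `h = h₀ + W` with `h₀`, `W` symmetric,
`h₀ S = λ S` and `h u = S`, then `λ⟨S, u⟩ + ⟨W S, u⟩ = ⟨S, S⟩`. [folklore: Birman–Schwinger /
second resolvent identity] -/
theorem SoloInformed.bs_identity (h h₀ W : E →ₗ[ℂ] E)
    (hdef : ∀ x : E, h x = h₀ x + W x)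
    (h₀symm : ∀ x y : E, ⟪h₀ x, y⟫_ℂ = ⟪x, h₀ y⟫_ℂ)
    (Wsymm : ∀ x y : E, ⟪W x, y⟫_ℂ = ⟪x, W y⟫_ℂ)
    {S u : E} {lam : ℝ} (hS : h₀ S = (lam : ℂ) • S) (hu : h u = S) :
    (lam : ℂ) * ⟪S, u⟫_ℂ + ⟪W S, u⟫_ℂ = ⟪S, S⟫_ℂ := by
  have h1 : ⟪S, S⟫_ℂ = ⟪S, h u⟫_ℂ := by rw [hu]
  rw [hdef u, inner_add_right, ← h₀symm S u, ← Wsymm S u, hS, inner_smul_left,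
    Complex.conj_ofReal] at h1
  exact h1.symm

/-- Real-part form of `bs_identity`: `λ·re⟨S, u⟩ + re⟨W S, u⟩ = ‖S‖²`. [folklore] -/
theorem SoloInformed.bs_identity_re (h h₀ W : E →ₗ[ℂ] E)
    (hdef : ∀ x : E, h x = h₀ x + W x)
    (h₀symm : ∀ x y : E, ⟪h₀ x, y⟫_ℂ = ⟪x, h₀ y⟫_ℂ)
    (Wsymm : ∀ x y : E, ⟪W x, y⟫_ℂ = ⟪x, W y⟫_ℂ)
    {S u : E} {lam : ℝ} (hS : h₀ S = (lam : ℂ) • S) (hu : h u = S) :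
    lam * (⟪S, u⟫_ℂ).re + (⟪W S, u⟫_ℂ).re = ‖S‖ ^ 2 := by
  have h1 := SoloInformed.bs_identity h h₀ W hdef h₀symm Wsymm hS hu
  have hSS : (⟪S, S⟫_ℂ).re = ‖S‖ ^ 2 := by
    rw [← RCLike.re_to_complex, inner_self_eq_norm_sq]
  have h2 := congrArg Complex.re h1
  rw [Complex.add_re, Complex.re_ofReal_mul, hSS] at h2
  exact h2

/-- **The Birman–Schwinger correction is at most first order.** If `h = h₀ + W`, `h ≥ 0`,
`h₀ A = λ A` and `h u = A`, then `λ·re⟨W A, u⟩ ≤ re⟨A, W A⟩` (i.e. `Q(A) ≤ ⟨A, W A⟩`: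
`(1 + K)⁻¹ ≤ 1`). [folklore] -/
theorem SoloInformed.bs_correction_le (h h₀ W : E →ₗ[ℂ] E)
    (hdef : ∀ x : E, h x = h₀ x + W x)
    (hpsd : ∀ x : E, 0 ≤ (⟪x, h x⟫_ℂ).re)
    {A u : E} {lam : ℝ} (hA : h₀ A = (lam : ℂ) • A) (hu : h u = A) :
    lam * (⟪W A, u⟫_ℂ).re ≤ (⟪A, W A⟫_ℂ).re := by
  -- w := A − λ u satisfies h w = W A
  set w : E := A - (lam : ℂ) • u with hw_def
  have hw : h w = W A := by
    rw [hw_def, map_sub, map_smul, hu, hdef A, hA, add_sub_cancel_left]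
  have hsmul : (lam : ℂ) • u = A - w := by
    rw [hw_def, sub_sub_cancel]
  have h2 : (lam : ℂ) * ⟪W A, u⟫_ℂ = ⟪W A, A⟫_ℂ - ⟪W A, w⟫_ℂ := by
    rw [← inner_smul_right, hsmul, inner_sub_right]
  have h3 : ⟪W A, w⟫_ℂ = ⟪h w, w⟫_ℂ := by rw [hw]
  have h4 : (⟪h w, w⟫_ℂ).re = (⟪w, h w⟫_ℂ).re := by
    rw [← inner_conj_symm w (h w), Complex.conj_re]
  have h5 : (⟪W A, A⟫_ℂ).re = (⟪A, W A⟫_ℂ).re := by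
    rw [← inner_conj_symm A (W A), Complex.conj_re]
  have h6 := congrArg Complex.re h2
  rw [Complex.re_ofReal_mul, Complex.sub_re, h3, h4, h5] at h6
  have h7 : 0 ≤ (⟪w, h w⟫_ℂ).re := hpsd w
  linarith

/-- **The Birman–Schwinger equation without square roots.** If `h = h₀ + W`, `h₀ S = λ S` with
`λ ≠ 0`, `h u = S`, `R₀` is a left inverse of `h₀` and `M = W + W R₀ W`, then `b := λ u` solves
`M b = W S`. [folklore] -/
theorem SoloInformed.bs_fixedPoint (h h₀ W R₀ M : E →ₗ[ℂ] E)
    (hdef : ∀ x : E, h x = h₀ x + W x)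
    (hR₀ : ∀ x : E, R₀ (h₀ x) = x)
    (hM : ∀ x : E, M x = W x + W (R₀ (W x)))
    {S u : E} {lam : ℝ} (hlam : lam ≠ 0) (hS : h₀ S = (lam : ℂ) • S) (hu : h u = S) :
    M ((lam : ℂ) • u) = W S := by
  have hlamC : (lam : ℂ) ≠ 0 := by exact_mod_cast hlam
  have hWu : W u = S - h₀ u := by
    have := hdef u
    rw [hu] at this
    exact eq_sub_of_add_eq' this.symm
  have hR₀S : (lam : ℂ) • R₀ S = S := by
    have := hR₀ S
    rw [hS, map_smul] at this
    exact this
  have e1 : W ((lam : ℂ) • u) = (lam : ℂ) • S - (lam : ℂ) • h₀ u := by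
    rw [map_smul, hWu, smul_sub]
  have e2 : R₀ ((lam : ℂ) • S - (lam : ℂ) • h₀ u) = S - (lam : ℂ) • u := by
    rw [map_sub, map_smul, map_smul, hR₀ u, hR₀S]
  have e3 : W (S - (lam : ℂ) • u) = W S - ((lam : ℂ) • S - (lam : ℂ) • h₀ u) := by
    rw [map_sub, e1]
  rw [hM, e1, e2, e3]
  abel

/-- `M = W + W R₀ W` is symmetric when `W` and `R₀` are. [folklore] -/
theorem SoloInformed.bs_M_symm (W R₀ M : E →ₗ[ℂ] E)
    (Wsymm : ∀ x y : E, ⟪W x, y⟫_ℂ = ⟪x, W y⟫_ℂ)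
    (R₀symm : ∀ x y : E, ⟪R₀ x, y⟫_ℂ = ⟪x, R₀ y⟫_ℂ)
    (hM : ∀ x : E, M x = W x + W (R₀ (W x))) (x y : E) :
    ⟪M x, y⟫_ℂ = ⟪x, M y⟫_ℂ := by
  rw [hM x, hM y, inner_add_left, inner_add_right, Wsymm x y, Wsymm (R₀ (W x)) y,
    R₀symm (W x) (W y), Wsymm x (R₀ (W y))]

/-- `M = W + W R₀ W` is positive when `W` is symmetric positive and `R₀` is positive. [folklore] -/
theorem SoloInformed.bs_M_psd (W R₀ M : E →ₗ[ℂ] E)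
    (Wsymm : ∀ x y : E, ⟪W x, y⟫_ℂ = ⟪x, W y⟫_ℂ)
    (Wpsd : ∀ x : E, 0 ≤ (⟪x, W x⟫_ℂ).re)
    (R₀psd : ∀ x : E, 0 ≤ (⟪x, R₀ x⟫_ℂ).re)
    (hM : ∀ x : E, M x = W x + W (R₀ (W x))) (x : E) :
    0 ≤ (⟪x, M x⟫_ℂ).re := by
  rw [hM x, inner_add_right, Complex.add_re, ← Wsymm x (R₀ (W x))]
  exact add_nonneg (Wpsd x) (R₀psd (W x))

/-- **Jensen lower bound on the Birman–Schwinger correction.** If `M` is symmetric positive, `W`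
symmetric and `M b = W S`, then `(re⟨S, W S⟩)² ≤ re⟨S, M S⟩ · re⟨S, W b⟩`
(i.e. `Q(S) ≥ ⟨S,WS⟩² / (⟨S,WS⟩ + ⟨WS, R₀ WS⟩)`). [folklore: Cauchy–Schwarz for the form of `M`] -/
theorem SoloInformed.bs_correction_jensen (M W : E →ₗ[ℂ] E)
    (Msymm : ∀ x y : E, ⟪M x, y⟫_ℂ = ⟪x, M y⟫_ℂ)
    (Mpsd : ∀ x : E, 0 ≤ (⟪x, M x⟫_ℂ).re)
    (Wsymm : ∀ x y : E, ⟪W x, y⟫_ℂ = ⟪x, W y⟫_ℂ)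
    {S b : E} (hfix : M b = W S) :
    (⟪S, W S⟫_ℂ).re ^ 2 ≤ (⟪S, M S⟫_ℂ).re * (⟪S, W b⟫_ℂ).re := by
  have hCS := SoloInformed.form_cauchySchwarz M Msymm Mpsd S b
  rw [hfix] at hCS
  have hb : (⟪b, W S⟫_ℂ).re = (⟪S, W b⟫_ℂ).re := by
    rw [← Wsymm b S, ← inner_conj_symm (W b) S, Complex.conj_re]
  rw [hb] at hCS
  exact hCS

/-- **Exchange identity.** With `h = h₀ + W` (`h₀`, `W` symmetric), `h₀ S = λ S`, `h₀ A = λ A`,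
`‖S‖ = ‖A‖`, `h u_S = S`, `h u_A = A`:
`λ (re⟨S, u_S⟩ − re⟨A, u_A⟩) = −(re⟨W S, u_S⟩ − re⟨W A, u_A⟩)`.  (Two bodies: `4Xλ² = −(Q(S) − Q(A))`.)
[folklore] -/
theorem SoloInformed.exchange_identity (h h₀ W : E →ₗ[ℂ] E)
    (hdef : ∀ x : E, h x = h₀ x + W x)
    (h₀symm : ∀ x y : E, ⟪h₀ x, y⟫_ℂ = ⟪x, h₀ y⟫_ℂ)
    (Wsymm : ∀ x y : E, ⟪W x, y⟫_ℂ = ⟪x, W y⟫_ℂ)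
    {S A uS uA : E} {lam : ℝ} (hS : h₀ S = (lam : ℂ) • S) (hA : h₀ A = (lam : ℂ) • A)
    (huS : h uS = S) (huA : h uA = A) (hnorm : ‖S‖ = ‖A‖) :
    lam * ((⟪S, uS⟫_ℂ).re - (⟪A, uA⟫_ℂ).re) =
      -((⟪W S, uS⟫_ℂ).re - (⟪W A, uA⟫_ℂ).re) := by
  have idS := SoloInformed.bs_identity_re h h₀ W hdef h₀symm Wsymm hS huS
  have idA := SoloInformed.bs_identity_re h h₀ W hdef h₀symm Wsymm hA huA
  have hn : ‖S‖ ^ 2 = ‖A‖ ^ 2 := by rw [hnorm]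
  linarith

/-- **Exchange sign from the Birman–Schwinger criterion (rung X₀, finite range).** In the setting of
`exchange_identity` with `h ≥ 0`, `W ≥ 0`, `R₀` a symmetric positive left inverse of `h₀`,
`M = W + W R₀ W`, `λ > 0`: if `re⟨A, W A⟩ · re⟨S, M S⟩ ≤ (re⟨S, W S⟩)²` and `re⟨S, M S⟩ > 0`, then
`re⟨S, u_S⟩ ≤ re⟨A, u_A⟩` (two bodies: `X ≤ 0`, the exchange-even channel is the stiffer one).
[folklore: Birman–Schwinger + Jensen; instantiation in the report §4.10(x)(d)] -/
theorem SoloInformed.exchange_sign_of_criterion (h h₀ W R₀ M : E →ₗ[ℂ] E)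
    (hdef : ∀ x : E, h x = h₀ x + W x)
    (h₀symm : ∀ x y : E, ⟪h₀ x, y⟫_ℂ = ⟪x, h₀ y⟫_ℂ)
    (Wsymm : ∀ x y : E, ⟪W x, y⟫_ℂ = ⟪x, W y⟫_ℂ)
    (R₀symm : ∀ x y : E, ⟪R₀ x, y⟫_ℂ = ⟪x, R₀ y⟫_ℂ)
    (hpsd : ∀ x : E, 0 ≤ (⟪x, h x⟫_ℂ).re)
    (Wpsd : ∀ x : E, 0 ≤ (⟪x, W x⟫_ℂ).re)
    (R₀psd : ∀ x : E, 0 ≤ (⟪x, R₀ x⟫_ℂ).re)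
    (hR₀ : ∀ x : E, R₀ (h₀ x) = x)
    (hM : ∀ x : E, M x = W x + W (R₀ (W x)))
    {S A uS uA : E} {lam : ℝ} (hlam : 0 < lam)
    (hS : h₀ S = (lam : ℂ) • S) (hA : h₀ A = (lam : ℂ) • A)
    (huS : h uS = S) (huA : h uA = A) (hnorm : ‖S‖ = ‖A‖)
    (hMpos : 0 < (⟪S, M S⟫_ℂ).re)
    (hcrit : (⟪A, W A⟫_ℂ).re * (⟪S, M S⟫_ℂ).re ≤ (⟪S, W S⟫_ℂ).re ^ 2) :
    (⟪S, uS⟫_ℂ).re ≤ (⟪A, uA⟫_ℂ).re := by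
  have idX := SoloInformed.exchange_identity h h₀ W hdef h₀symm Wsymm hS hA huS huA hnorm
  have cA := SoloInformed.bs_correction_le h h₀ W hdef hpsd hA huA
  have hfix := SoloInformed.bs_fixedPoint h h₀ W R₀ M hdef hR₀ hM (ne_of_gt hlam) hS huS
  have Msymm := SoloInformed.bs_M_symm W R₀ M Wsymm R₀symm hM
  have Mpsd := SoloInformed.bs_M_psd W R₀ M Wsymm Wpsd R₀psd hM
  have jS := SoloInformed.bs_correction_jensen M W Msymm Mpsd Wsymm hfix
  -- re⟨S, W (λ uS)⟩ = λ · re⟨W S, uS⟩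
  have hq : (⟪S, W ((lam : ℂ) • uS)⟫_ℂ).re = lam * (⟪W S, uS⟫_ℂ).re := by
    rw [map_smul, inner_smul_right, Complex.re_ofReal_mul, ← Wsymm S uS]
  rw [hq] at jS
  -- chain: λ·qA·m ≤ a·m ≤ w² ≤ m·λ·qS, with m > 0
  set m := (⟪S, M S⟫_ℂ).re with hm_def
  set a := (⟪A, W A⟫_ℂ).re with ha_def
  set qS := (⟪W S, uS⟫_ℂ).re with hqS_def
  set qA := (⟪W A, uA⟫_ℂ).re with hqA_def
  have s1 : a * m ≤ (lam * qS) * m := by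
    have := le_trans hcrit jS
    linarith
  have s2 : a ≤ lam * qS := le_of_mul_le_mul_right s1 hMpos
  have s3 : lam * qA ≤ lam * qS := le_trans cA s2
  have s4 : qA ≤ qS := le_of_mul_le_mul_left s3 hlam
  have s5 : lam * (⟪S, uS⟫_ℂ).re ≤ lam * (⟪A, uA⟫_ℂ).re := by linarith
  exact le_of_mul_le_mul_left s5 hlam

/-- **Exchange sign for contact interactions (rung X₀, all momenta, all couplings).** In the same
setting, if the exchange-odd vector does not see the interaction, `W A = 0`, then
`re⟨S, u_S⟩ ≤ re⟨A, u_A⟩` with no further condition (two bodies with on-site / contact repulsion: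
`X(k) ≤ 0` for every `k ≠ 0`). [folklore: Birman–Schwinger] -/
theorem SoloInformed.exchange_sign_of_contact (h h₀ W R₀ M : E →ₗ[ℂ] E)
    (hdef : ∀ x : E, h x = h₀ x + W x)
    (h₀symm : ∀ x y : E, ⟪h₀ x, y⟫_ℂ = ⟪x, h₀ y⟫_ℂ)
    (Wsymm : ∀ x y : E, ⟪W x, y⟫_ℂ = ⟪x, W y⟫_ℂ)
    (Wpsd : ∀ x : E, 0 ≤ (⟪x, W x⟫_ℂ).re)
    (R₀psd : ∀ x : E, 0 ≤ (⟪x, R₀ x⟫_ℂ).re)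
    (hR₀ : ∀ x : E, R₀ (h₀ x) = x)
    (hM : ∀ x : E, M x = W x + W (R₀ (W x)))
    {S A uS uA : E} {lam : ℝ} (hlam : 0 < lam)
    (hS : h₀ S = (lam : ℂ) • S) (hA : h₀ A = (lam : ℂ) • A)
    (huS : h uS = S) (huA : h uA = A) (hnorm : ‖S‖ = ‖A‖)
    (hWA : W A = 0) :
    (⟪S, uS⟫_ℂ).re ≤ (⟪A, uA⟫_ℂ).re := by
  have idX := SoloInformed.exchange_identity h h₀ W hdef h₀symm Wsymm hS hA huS huA hnorm
  have hfix := SoloInformed.bs_fixedPoint h h₀ W R₀ M hdef hR₀ hM (ne_of_gt hlam) hS huS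
  have Mpsd := SoloInformed.bs_M_psd W R₀ M Wsymm Wpsd R₀psd hM
  have qA0 : (⟪W A, uA⟫_ℂ).re = 0 := by rw [hWA, inner_zero_left, Complex.zero_re]
  -- λ · re⟨W S, uS⟩ = re⟨M b, b⟩ = re⟨b, M b⟩ ≥ 0 with b = λ uS
  have q1 : ((lam : ℂ) * ⟪W S, uS⟫_ℂ).re = (⟪M ((lam : ℂ) • uS), (lam : ℂ) • uS⟫_ℂ).re := by
    rw [← inner_smul_right, hfix]
  rw [Complex.re_ofReal_mul, ← inner_conj_symm (M ((lam : ℂ) • uS)) ((lam : ℂ) • uS),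
    Complex.conj_re] at q1
  have q2 : 0 ≤ lam * (⟪W S, uS⟫_ℂ).re := by rw [q1]; exact Mpsd _
  have s4 : (⟪W A, uA⟫_ℂ).re ≤ (⟪W S, uS⟫_ℂ).re := by
    rw [qA0]
    exact le_of_mul_le_mul_left (by simpa using q2) hlam
  have s5 : lam * (⟪S, uS⟫_ℂ).re ≤ lam * (⟪A, uA⟫_ℂ).re := by linarith
  exact le_of_mul_le_mul_left s5 hlam

end Summit.AtomisticToContinuum.BoseEinsteinCondensation.Theorems

end
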